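import Summits.CriticalPhenomena.SAWScalingLimit.Theorems.BoundaryClosureNegative_Instance

/-!
# The CANONICAL honeycomb mesh of the half-disc `HD` is connected (crux `ObservableToSLE`,
stmt-CriticalPhenomena-10472; cdisprove cycle 4) — part 1 of the floor-class non-vacuity certificate

Negative/structural lemma (refuter).  The picked line `floor-ratio-restriction-bootstrap` identifies
subsequential limits first on the FLOOR CLASS, whose endpoint approximations (`IsFloorEndpointApprox`)
live in the CANONICAL discretisation `Ω_δ` of `HexSAW.lean` (largest component of the honeycomb mesh
graph, closed-segment edges).  To certify that this class is inhabited one needs reachability in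
`Ω_δ` of a concrete floor domain; the tree's only engine (`HexConjecture.Negative.NonVacuity`, unit
disc) descends `9‖c‖² = A² + AB + B²` radially and does not respect a floor.  This file supplies the
half-disc engine: the honeycomb mesh graph of `HD = {‖z‖ < 1, im z > 0}` is CONNECTED for `0 < δ < 1`
(`meshHDGraph_reachable`) — descent `up-face ↦ the down-face below it`, `down-face ↦ the lower
row-neighbour on the side of the imaginary axis` (norm non-increasing, height index `2r + (j mod 2)`
drops by one: `descent_even`, `descent_odd`, `exists_bottom_reachable`) to the bottom zigzag
`fj (2k) 0`, then along row `0` to `fj 0 0` (`bottom_reachable_origin`, norms non-increasing); hence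
`Ω_δ(HD)` is the whole mesh (`embMeshDomain_HD_eq`) and reachability in `Ω_δ(HD)` is membership
(`hexDomainGraph_HD_reachable`).  Part 2 (`FloorClassNonVacuity.lean`) builds the floor endpoints and
the inhabited floor class on `(HD; 1/4, 0)`; a worker on `stub_canonicalTransfer` needs exactly this
engine.  Everything proved. [folklore]
-/

noncomputable section

open Set Filter Topology Complex
open Literature.Probability.RandomPlanarGeometry
open UpperHalfPlane (upperHalfPlaneSet)
open Literature.Probability.LatticeModels Literature.Probability.RandomPlanarGeometry.SAW
open Summit.CriticalPhenomena.SAWScalingLimit.Theorems.BoundaryClosure.Negative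

namespace Summit.CriticalPhenomena.SAWScalingLimit.Theorems.ObservableToSLE.Negative

/-! ## §1 The canonical honeycomb mesh of the half-disc is connected -/

section Mesh

variable {δ : ℝ}

/-- The honeycomb mesh vertex set of the half-disc `HD`. -/
abbrev meshHD (δ : ℝ) : Set HexVertex := embMeshVertices hexCenter HD δ

/-- The honeycomb mesh graph of the half-disc, induced on its vertex set. -/
abbrev meshHDGraph (δ : ℝ) : SimpleGraph (meshHD δ) := embMeshVertexGraph hexGraph hexCenter HD δ

/-- Membership in the mesh of the half-disc: `δ ‖c‖ < 1` and `im c > 0`. [folklore] -/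
theorem mem_meshHD_iff (hδ : 0 < δ) {v : HexVertex} :
    v ∈ meshHD δ ↔ δ * ‖hexCenter v‖ < 1 ∧ 0 < (hexCenter v).im := by
  rw [mem_embMeshVertices_iff]
  show (δ : ℂ) * hexCenter v ∈ HD ↔ _
  simp only [HD, mem_setOf_eq, norm_mul, Complex.norm_real, Real.norm_eq_abs, abs_of_pos hδ,
    Complex.im_ofReal_mul]
  constructor
  · rintro ⟨h1, h2⟩; exact ⟨h1, pos_of_mul_pos_right h2 hδ.le⟩
  · rintro ⟨h1, h2⟩; exact ⟨h1, mul_pos hδ h2⟩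

/-- A face of positive height with a centre no farther from the origin is a mesh vertex if the
other one is. [folklore] -/
theorem mem_meshHD_of_le (hδ : 0 < δ) {v w : HexVertex} (hv : v ∈ meshHD δ)
    (hn : ‖hexCenter w‖ ≤ ‖hexCenter v‖) (hi : 0 < (hexCenter w).im) : w ∈ meshHD δ := by
  rw [mem_meshHD_iff hδ] at hv ⊢
  exact ⟨lt_of_le_of_lt (mul_le_mul_of_nonneg_left hn hδ.le) hv.1, hi⟩

/-- Honeycomb neighbours inside the half-disc are mesh-graph neighbours (`HD` is convex, so the
rescaled segment stays in the closed half-disc). [folklore] -/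
theorem meshHDGraph_adj (u w : meshHD δ) (hadj : hexGraph.Adj u.1 w.1) : (meshHDGraph δ).Adj u w := by
  rw [SimpleGraph.induce_adj, embMeshGraph_adj_iff]
  exact ⟨hadj, (convex_HD.segment_subset u.2 w.2).trans subset_closure⟩

/-- Positive height means nonnegative row. [folklore] -/
theorem im_pos_iff_row_nonneg (j r : ℤ) : 0 < (hexCenter (fj j r)).im ↔ 0 ≤ r := by
  obtain ⟨lo, hi⟩ := im_hexCenter_fj_bounds j r
  have hs : 0 < Real.sqrt 3 / 2 := by positivity
  constructor
  · intro h
    by_contra hr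
    have hr' : (r : ℝ) ≤ -1 := by exact_mod_cast (show r ≤ -1 by omega)
    have : ((r : ℝ) + 2 / 3) * (Real.sqrt 3 / 2) < 0 := mul_neg_of_neg_of_pos (by linarith) hs
    linarith
  · intro h
    have h0 : (0 : ℝ) ≤ r := by exact_mod_cast h
    have : 0 < ((r : ℝ) + 1 / 3) * (Real.sqrt 3 / 2) := mul_pos (by linarith) hs
    linarith

/-- Height of an up-face (`j` even) of row `r`: `(r + 1/3)(√3/2)`. [folklore] -/
theorem im_fj_even {j : ℤ} (hj : j % 2 = 0) (r : ℤ) :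
    (hexCenter (fj j r)).im = ((r : ℝ) + 1 / 3) * (Real.sqrt 3 / 2) := by
  rw [im_hexCenter_fj, hj]; push_cast; ring

/-- Height of a down-face (`j` odd) of row `r`: `(r + 2/3)(√3/2)`. [folklore] -/
theorem im_fj_odd {j : ℤ} (hj : j % 2 = 1) (r : ℤ) :
    (hexCenter (fj j r)).im = ((r : ℝ) + 2 / 3) * (Real.sqrt 3 / 2) := by
  rw [im_hexCenter_fj, hj]; push_cast; ring

/-- `(√3/2)² = 3/4` (local copy of a Literature triviality, kept private). [folklore] -/
private theorem sqrt3_half_sq : (Real.sqrt 3 / 2) ^ 2 = 3 / 4 := by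
  rw [div_pow, Real.sq_sqrt (by norm_num)]; norm_num

/-- **Descent step from an up-face of row `r ≥ 1`**: the down-face below it has the same abscissa
and a smaller positive height, hence a centre no farther from the origin. [folklore] -/
theorem descent_even {j r : ℤ} (hj : j % 2 = 0) (hr : 1 ≤ r) :
    hexGraph.Adj (fj j r) (fj (j + 1) (r - 1)) ∧
      ‖hexCenter (fj (j + 1) (r - 1))‖ ≤ ‖hexCenter (fj j r)‖ ∧
        0 < (hexCenter (fj (j + 1) (r - 1))).im := by
  have hs : 0 < Real.sqrt 3 / 2 := by positivity
  have hj' : (j + 1) % 2 = 1 := by omega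
  have hre : reA (j + 1) (r - 1) = reA j r := by unfold reA; push_cast; ring
  have hi0 := im_fj_even hj r
  have hi1 := im_fj_odd hj' (r - 1)
  have hr' : (1 : ℝ) ≤ r := by exact_mod_cast hr
  refine ⟨adj_fj_down hj r, ?_, ?_⟩
  · rw [← sq_le_sq₀ (norm_nonneg _) (norm_nonneg _), norm_sq_hexCenter_fj, norm_sq_hexCenter_fj, hre,
      hi0, hi1, mul_pow, mul_pow, sqrt3_half_sq]
    push_cast
    nlinarith
  · rw [hi1]; push_cast; exact mul_pos (by linarith) hs

/-- **Descent step from a down-face of row `r ≥ 0`**: one of its two row-neighbours (up-faces, lower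
by `√3/6`) — the one on the side of the imaginary axis — has a centre no farther from the origin.
[folklore] -/
theorem descent_odd {j r : ℤ} (hj : j % 2 = 1) (hr : 0 ≤ r) :
    ∃ j' : ℤ, j' % 2 = 0 ∧ hexGraph.Adj (fj j r) (fj j' r) ∧
      ‖hexCenter (fj j' r)‖ ≤ ‖hexCenter (fj j r)‖ ∧ 0 < (hexCenter (fj j' r)).im := by
  have hs : 0 < Real.sqrt 3 / 2 := by positivity
  have hr' : (0 : ℝ) ≤ r := by exact_mod_cast hr
  have hi1 := im_fj_odd hj r
  by_cases hpos : 1 ≤ j + r + 1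
  · -- abscissa `≥ 1/2`: step towards the axis, to `j - 1`
    have hj' : (j - 1) % 2 = 0 := by omega
    have hi0 := im_fj_even hj' r
    have hadj : hexGraph.Adj (fj j r) (fj (j - 1) r) := by
      have h := adj_fj_succ (j - 1) r
      rw [sub_add_cancel] at h
      exact h.symm
    refine ⟨j - 1, hj', hadj, ?_, ?_⟩
    · have hp : (1 : ℝ) ≤ j + r + 1 := by exact_mod_cast hpos
      rw [← sq_le_sq₀ (norm_nonneg _) (norm_nonneg _), norm_sq_hexCenter_fj, norm_sq_hexCenter_fj,
        hi0, hi1, mul_pow, mul_pow, sqrt3_half_sq]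
      unfold reA
      push_cast
      nlinarith
    · rw [hi0]; exact mul_pos (by linarith) hs
  · -- abscissa `≤ 0`: step towards the axis, to `j + 1`
    have hj' : (j + 1) % 2 = 0 := by omega
    have hi0 := im_fj_even hj' r
    refine ⟨j + 1, hj', adj_fj_succ j r, ?_, ?_⟩
    · have hp : (j : ℝ) + r + 1 ≤ 0 := by exact_mod_cast (show j + r + 1 ≤ 0 by omega)
      rw [← sq_le_sq₀ (norm_nonneg _) (norm_nonneg _), norm_sq_hexCenter_fj, norm_sq_hexCenter_fj,
        hi0, hi1, mul_pow, mul_pow, sqrt3_half_sq]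
      unfold reA
      push_cast
      nlinarith
    · rw [hi0]; exact mul_pos (by linarith) hs

/-- The height index `2 r + (j mod 2)` of a face (`0` exactly on the bottom up-faces `fj (2k) 0`). -/
def hidx (v : HexVertex) : ℤ := 2 * rOf v + jOf v % 2

/-- **Phase 1: every mesh vertex of the half-disc is joined, inside the mesh graph, to a bottom
up-face `fj (2k) 0`.** [folklore] -/
theorem exists_bottom_reachable (hδ : 0 < δ) (u : meshHD δ) :
    ∃ (k : ℤ) (h : fj (2 * k) 0 ∈ meshHD δ), (meshHDGraph δ).Reachable u ⟨fj (2 * k) 0, h⟩ := by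
  suffices H : ∀ (n : ℕ) (u : meshHD δ), hidx u.1 ≤ n →
      ∃ (k : ℤ) (h : fj (2 * k) 0 ∈ meshHD δ), (meshHDGraph δ).Reachable u ⟨fj (2 * k) 0, h⟩ by
    have hr : 0 ≤ rOf u.1 := by
      have hm := ((mem_meshHD_iff hδ).1 u.2).2
      rw [← fj_jOf_rOf u.1] at hm
      exact (im_pos_iff_row_nonneg _ _).1 hm
    refine H (hidx u.1).toNat u ?_
    exact Int.self_le_toNat _
  intro n
  induction n with
  | zero =>
    intro u hn
    have hm := (mem_meshHD_iff hδ).1 u.2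
    have hr : 0 ≤ rOf u.1 := by
      have h2 := hm.2
      rw [← fj_jOf_rOf u.1] at h2
      exact (im_pos_iff_row_nonneg _ _).1 h2
    unfold hidx at hn
    have hr0 : rOf u.1 = 0 := by omega
    have hj0 : jOf u.1 % 2 = 0 := by omega
    have heq : fj (2 * (jOf u.1 / 2)) 0 = u.1 := by
      rw [show 2 * (jOf u.1 / 2) = jOf u.1 by omega, ← hr0, fj_jOf_rOf]
    have hmem : fj (2 * (jOf u.1 / 2)) 0 ∈ meshHD δ := by rw [heq]; exact u.2
    refine ⟨jOf u.1 / 2, hmem, ?_⟩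
    have : (⟨fj (2 * (jOf u.1 / 2)) 0, hmem⟩ : meshHD δ) = u := Subtype.ext heq
    rw [this]
  | succ n ih =>
    intro u hn
    have hm := (mem_meshHD_iff hδ).1 u.2
    have hr : 0 ≤ rOf u.1 := by
      have h2 := hm.2
      rw [← fj_jOf_rOf u.1] at h2
      exact (im_pos_iff_row_nonneg _ _).1 h2
    by_cases hle : hidx u.1 ≤ n
    · exact ih u hle
    · -- `hidx u = n + 1 ≥ 1`: one descent step, then the induction hypothesis
      set j := jOf u.1 with hj_def
      set r := rOf u.1 with hr_def
      have hu : fj j r = u.1 := fj_jOf_rOf u.1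
      have hmu : fj j r ∈ meshHD δ := by rw [hu]; exact u.2
      rcases Int.emod_two_eq_zero_or_one j with hj | hj
      · -- up-face of row `r ≥ 1`
        have hr1 : 1 ≤ r := by
          unfold hidx at hle hn; rw [← hj_def, ← hr_def] at hle hn; omega
        obtain ⟨hadj, hnorm, him⟩ := descent_even hj hr1
        have hw : fj (j + 1) (r - 1) ∈ meshHD δ := mem_meshHD_of_le hδ hmu hnorm him
        have hidxw : hidx (fj (j + 1) (r - 1)) ≤ n := by
          unfold hidx at hn ⊢
          rw [jOf_fj, rOf_fj]
          rw [← hj_def, ← hr_def] at hn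
          omega
        obtain ⟨k, hk, hreach⟩ := ih ⟨fj (j + 1) (r - 1), hw⟩ hidxw
        refine ⟨k, hk, SimpleGraph.Reachable.trans ?_ hreach⟩
        have hadj' : (meshHDGraph δ).Adj u ⟨fj (j + 1) (r - 1), hw⟩ :=
          meshHDGraph_adj _ _ (by rw [← hu]; exact hadj)
        exact hadj'.reachable
      · -- down-face of row `r ≥ 0`
        obtain ⟨j', hj', hadj, hnorm, him⟩ := descent_odd hj hr
        have hw : fj j' r ∈ meshHD δ := mem_meshHD_of_le hδ hmu hnorm him
        have hidxw : hidx (fj j' r) ≤ n := by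
          unfold hidx at hn ⊢
          rw [jOf_fj, rOf_fj, hj']
          rw [← hj_def, ← hr_def, hj] at hn
          omega
        obtain ⟨k, hk, hreach⟩ := ih ⟨fj j' r, hw⟩ hidxw
        refine ⟨k, hk, SimpleGraph.Reachable.trans ?_ hreach⟩
        have hadj' : (meshHDGraph δ).Adj u ⟨fj j' r, hw⟩ :=
          meshHDGraph_adj _ _ (by rw [← hu]; exact hadj)
        exact hadj'.reachable

/-- Squared norm of a bottom up-face: `‖c(fj (2k) 0)‖² = (k + 1/2)² + 1/12`. [folklore] -/
theorem norm_sq_bottom_even (k : ℤ) : ‖hexCenter (fj (2 * k) 0)‖ ^ 2 = ((k : ℝ) + 1 / 2) ^ 2 + 1 / 12 := by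
  rw [norm_sq_hexCenter_fj, im_fj_even (show (2 * k) % 2 = 0 by omega), mul_pow, sqrt3_half_sq]
  unfold reA; push_cast; ring

/-- Squared norm of a bottom down-face: `‖c(fj (2k+1) 0)‖² = (k + 1)² + 1/3`. [folklore] -/
theorem norm_sq_bottom_odd (k : ℤ) : ‖hexCenter (fj (2 * k + 1) 0)‖ ^ 2 = ((k : ℝ) + 1) ^ 2 + 1 / 3 := by
  rw [norm_sq_hexCenter_fj, im_fj_odd (show (2 * k + 1) % 2 = 1 by omega), mul_pow, sqrt3_half_sq]
  unfold reA; push_cast; ring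

/-- Bottom faces have positive height. [folklore] -/
theorem im_pos_row_zero (j : ℤ) : 0 < (hexCenter (fj j 0)).im :=
  (im_pos_iff_row_nonneg j 0).2 le_rfl

/-- The origin face `fj 0 0` (centre `1/2 + i√3/6`, norm `1/√3`) is a mesh vertex for `δ < 1`. [folklore] -/
theorem origin_mem (hδ : 0 < δ) (hδ1 : δ < 1) : fj 0 0 ∈ meshHD δ := by
  rw [mem_meshHD_iff hδ]
  refine ⟨?_, im_pos_row_zero 0⟩
  have hn : ‖hexCenter (fj 0 0)‖ ^ 2 = 1 / 3 := by
    have := norm_sq_bottom_even 0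
    simp only [mul_zero, Int.cast_zero, zero_add] at this
    rw [this]; norm_num
  have h1 : ‖hexCenter (fj 0 0)‖ < 1 := by
    have : ‖hexCenter (fj 0 0)‖ ^ 2 < 1 := by rw [hn]; norm_num
    exact (pow_lt_one_iff_of_nonneg (norm_nonneg _) two_ne_zero).1 this
  exact mul_lt_one_of_nonneg_of_lt_one_left hδ.le hδ1 h1.le

/-- **Phase 2: along row `0` every bottom up-face `fj (2k) 0` of the mesh is joined to `fj 0 0`**
(two steps per cell towards the axis; norms do not increase). [folklore] -/
theorem bottom_reachable_origin (hδ : 0 < δ) (hδ1 : δ < 1) (k : ℤ) (h : fj (2 * k) 0 ∈ meshHD δ) :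
    (meshHDGraph δ).Reachable ⟨fj (2 * k) 0, h⟩ ⟨fj 0 0, origin_mem hδ hδ1⟩ := by
  suffices H : ∀ (n : ℕ) (k : ℤ) (h : fj (2 * k) 0 ∈ meshHD δ), k.natAbs ≤ n →
      (meshHDGraph δ).Reachable ⟨fj (2 * k) 0, h⟩ ⟨fj 0 0, origin_mem hδ hδ1⟩ from H _ k h le_rfl
  intro n
  induction n with
  | zero =>
    intro k h hk
    have hk0 : k = 0 := by omega
    subst hk0
    exact SimpleGraph.Reachable.refl _
  | succ n ih =>
    intro k h hk
    by_cases hk0 : k = 0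
    · subst hk0; exact SimpleGraph.Reachable.refl _
    rcases lt_or_gt_of_ne hk0 with hneg | hpos
    · -- `k ≤ -1`: `fj (2k) 0 → fj (2k+1) 0 → fj (2k+2) 0 = fj (2(k+1)) 0`
      have hk' : (k : ℝ) ≤ -1 := by exact_mod_cast (show k ≤ -1 by omega)
      have hn1 : ‖hexCenter (fj (2 * k + 1) 0)‖ ≤ ‖hexCenter (fj (2 * k) 0)‖ := by
        rw [← sq_le_sq₀ (norm_nonneg _) (norm_nonneg _), norm_sq_bottom_odd, norm_sq_bottom_even]
        nlinarith
      have hm1 : fj (2 * k + 1) 0 ∈ meshHD δ := mem_meshHD_of_le hδ h hn1 (im_pos_row_zero _)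
      have hn2 : ‖hexCenter (fj (2 * (k + 1)) 0)‖ ≤ ‖hexCenter (fj (2 * k + 1) 0)‖ := by
        rw [← sq_le_sq₀ (norm_nonneg _) (norm_nonneg _), norm_sq_bottom_odd, norm_sq_bottom_even]
        push_cast; nlinarith
      have hm2 : fj (2 * (k + 1)) 0 ∈ meshHD δ := mem_meshHD_of_le hδ hm1 hn2 (im_pos_row_zero _)
      have e1 : (meshHDGraph δ).Adj ⟨fj (2 * k) 0, h⟩ ⟨fj (2 * k + 1) 0, hm1⟩ :=
        meshHDGraph_adj _ _ (adj_fj_succ (2 * k) 0)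
      have e2 : (meshHDGraph δ).Adj ⟨fj (2 * k + 1) 0, hm1⟩ ⟨fj (2 * (k + 1)) 0, hm2⟩ :=
        meshHDGraph_adj _ _ (by
          have := adj_fj_succ (2 * k + 1) 0
          rwa [show 2 * k + 1 + 1 = 2 * (k + 1) by ring] at this)
      exact (e1.reachable.trans e2.reachable).trans (ih (k + 1) hm2 (by omega))
    · -- `k ≥ 1`: `fj (2k) 0 → fj (2k-1) 0 = fj (2(k-1)+1) 0 → fj (2(k-1)) 0`
      have hk' : (1 : ℝ) ≤ k := by exact_mod_cast (show 1 ≤ k by omega)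
      have hn1 : ‖hexCenter (fj (2 * (k - 1) + 1) 0)‖ ≤ ‖hexCenter (fj (2 * k) 0)‖ := by
        rw [← sq_le_sq₀ (norm_nonneg _) (norm_nonneg _), norm_sq_bottom_odd, norm_sq_bottom_even]
        push_cast; nlinarith
      have hm1 : fj (2 * (k - 1) + 1) 0 ∈ meshHD δ := mem_meshHD_of_le hδ h hn1 (im_pos_row_zero _)
      have hn2 : ‖hexCenter (fj (2 * (k - 1)) 0)‖ ≤ ‖hexCenter (fj (2 * (k - 1) + 1) 0)‖ := by
        rw [← sq_le_sq₀ (norm_nonneg _) (norm_nonneg _), norm_sq_bottom_odd, norm_sq_bottom_even]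
        push_cast; nlinarith
      have hm2 : fj (2 * (k - 1)) 0 ∈ meshHD δ := mem_meshHD_of_le hδ hm1 hn2 (im_pos_row_zero _)
      have e1 : (meshHDGraph δ).Adj ⟨fj (2 * k) 0, h⟩ ⟨fj (2 * (k - 1) + 1) 0, hm1⟩ :=
        meshHDGraph_adj _ _ (by
          have := adj_fj_succ (2 * (k - 1) + 1) 0
          rw [show 2 * (k - 1) + 1 + 1 = 2 * k by ring] at this
          exact this.symm)
      have e2 : (meshHDGraph δ).Adj ⟨fj (2 * (k - 1) + 1) 0, hm1⟩ ⟨fj (2 * (k - 1)) 0, hm2⟩ :=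
        meshHDGraph_adj _ _ (adj_fj_succ (2 * (k - 1)) 0).symm
      exact (e1.reachable.trans e2.reachable).trans (ih (k - 1) hm2 (by omega))

/-- **The honeycomb mesh graph of the half-disc is connected** (`0 < δ < 1`). [folklore] -/
theorem meshHDGraph_reachable (hδ : 0 < δ) (hδ1 : δ < 1) (u w : meshHD δ) :
    (meshHDGraph δ).Reachable u w := by
  obtain ⟨k, hk, hr⟩ := exists_bottom_reachable hδ u
  obtain ⟨k', hk', hr'⟩ := exists_bottom_reachable hδ w
  exact (hr.trans (bottom_reachable_origin hδ hδ1 k hk)).trans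
    (hr'.trans (bottom_reachable_origin hδ hδ1 k' hk')).symm

/-- Hence the discrete domain `Ω_δ` of the half-disc is the WHOLE mesh (one component). [folklore] -/
theorem embMeshDomain_HD_eq (hδ : 0 < δ) (hδ1 : δ < 1) :
    embMeshDomain hexGraph hexCenter HD δ = meshHD δ := by
  refine (embMeshDomain_subset _ _ _ _).antisymm fun v hv => ?_
  simp only [embMeshDomain, Set.mem_iUnion, Set.mem_image]
  refine ⟨(meshHDGraph δ).connectedComponentMk ⟨v, hv⟩, fun C' => ?_, ⟨v, hv⟩, rfl, rfl⟩
  induction C' using SimpleGraph.ConnectedComponent.ind with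
  | h u =>
    rw [SimpleGraph.ConnectedComponent.sound (meshHDGraph_reachable hδ hδ1 u ⟨v, hv⟩)]

/-- … and reachability in `Ω_δ(HD)` is just membership in the half-disc (`0 < δ < 1`). [folklore] -/
theorem hexDomainGraph_HD_reachable (hδ : 0 < δ) (hδ1 : δ < 1) {u w : HexVertex}
    (hu : u ∈ meshHD δ) (hw : w ∈ meshHD δ) : (hexDomainGraph HD δ).Reachable u w := by
  let φ : meshHDGraph δ →g hexDomainGraph HD δ :=
    { toFun := Subtype.val
      map_rel' := fun {a b} h => (embDomainGraph_adj_iff hexGraph hexCenter).2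
        ⟨SimpleGraph.induce_adj.1 h, (embMeshDomain_HD_eq hδ hδ1).symm ▸ a.2,
          (embMeshDomain_HD_eq hδ hδ1).symm ▸ b.2⟩ }
  exact (meshHDGraph_reachable hδ hδ1 ⟨u, hu⟩ ⟨w, hw⟩).map φ

end Mesh

end Summit.CriticalPhenomena.SAWScalingLimit.Theorems.ObservableToSLE.Negative

end
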